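import Summits.QuantumFields.YangMills.Theses.ParabolicTrajectory
import Summits.QuantumFields.YangMills.Theorems.ParabolicTrajectoryLatticeGapOnTrajectoryDefs
import Summits.QuantumFields.YangMills.Theorems.ParabolicTrajectoryLatticeGapOnTrajectoryStubWilsonTorusDLR
import Summits.QuantumFields.YangMills.Theorems.ParabolicTrajectoryLatticeGapOnTrajectoryStubSpecificationTower
import Summits.QuantumFields.YangMills.Theorems.ParabolicTrajectoryLatticeGapOnTrajectoryStubKRFiniteSizeDecay
import Summits.QuantumFields.YangMills.Theorems.ParabolicTrajectoryLatticeGapOnTrajectoryStubTorusFrames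
import Summits.QuantumFields.YangMills.Theorems.ParabolicTrajectoryLatticeGapOnTrajectoryStubSmoothingToGap
import Summits.QuantumFields.YangMills.Theorems.ParabolicTrajectoryLatticeGapOnTrajectoryTransferFromOSGap
import Summits.QuantumFields.YangMills.Theorems.ParabolicTrajectoryLatticeGapOnTrajectoryStubNegReflectRP
import Summits.QuantumFields.YangMills.Theorems.ParabolicTrajectoryLatticeGapOnTrajectoryStubSlabClustering
import Summits.QuantumFields.YangMills.Theorems.ParabolicTrajectoryLatticeGapOnTrajectoryTransferSymDefs

/-!
# Line `orbit-kantorovich-finite-size` — skeleton for crux `ParabolicTrajectory.LatticeGapOnTrajectory`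
(stmt-QuantumFields-10523, conjunct (B) of route ParabolicTrajectory rev 4), crux-plan round 1.

**Idea (Cruxes/LatticeGapOnTrajectory/Ideas/orbit-kantorovich-finite-size.md; triage r1-1/2/3: pass).**
Weak coupling is LOW temperature for the link variables but the physical cell is CRITICAL-HARMONIC for orbits:
read Wilson's torus measure at `β_k` as a specification on CELLS of side `b_k = t·M^{n_k}` lattice units
(`t` crux units), measure boundary data in the capped gauge-ORBIT transport weight
`w_c(U, U') = min(1, inf_g sup_{e ∈ c} d_r(U_e, (U'^g)_e)/α)` (`g` over gauge transformations at the
cell's interior sites), and ask for Dobrushin–Shlosman's finite-size condition in KANTOROVICH form at ONE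
window shape `(2n₀+1)⁴` cells, eventually in `k`, with `k`-uniform `(n₀, γ₀ < 1)` — `stub_orbitKantorovichWindow`
(THE PHYSICS, open, hardest: marginal exactly at tree level, failed exactly by an `Ad`-invariant direction of `𝔤`).
The engine `stub_krFiniteSizeDecay` (DS85 in the dual-Lipschitz = Dobrushin-1970/Föllmer form, on a finite 4-d
torus of cells, no translation invariance: "received" sum condition) turns the window condition into covariance
decay `C₀ (Σδ_f)(Σδ_g) e^{-κ D}` for cell-Lipschitz observables under ANY Gibbs measure of the cell specification,
with `(κ, C₀)` depending on `(n₀, γ₀, R)` only; run on the SYMMETRIC torus `(2S+1)⁴` itself (a finite site set)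
it needs no transfer matrix and no thermal-trace control — `S`-uniformity is automatic (card (iv)).
`stub_wilsonTorusDLR` (Wilson's torus measure is a Gibbs measure of the torus Wilson specification) feeds it the
crux's measure; `stub_smoothingToGap` (tower property `cov(A,B) = cov(γ_W A, γ_W B)` + frames adapted to the
supports + geometry) reaches the crux's `HasLatticeMassGap` for ALL bounded measurable species through the second,
`G`-blind physics clause `RoughCentreBound` (UV decoupling: the shell moves lattice-local links at the window
centre by `a_k²ε ≪ g_k`); `stub_transfer` is the transfer half (Disproof PROVER NOTE, weakened to "∃ rate").

Stubs (registered, reshape 4c — lead c3, 2026-08-16): landed `stub_krFiniteSizeDecay`, `stub_wilsonTorusDLR`, `stub_torusFrames`,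
`stub_specificationTower`, `stub_smoothingToGap`, `stub_negReflectRP` (p120012), `stub_slabClustering` (p123095), `stub_transferSym` (p121787);
sorried `stub_orbitKantorovichWindow` (physics), `stub_volume` (residual β), `stub_symmetrise` (residual α). Composition (no hypotheses,
concludes the crux BY NAME, sorry only inside the stubs it calls): `LatticeGapOnTrajectory_of`.

Disproof.lean (v3.7, RESISTS) used: §2 `concl_iff_split` — the two halves are produced at INDEPENDENT rates and
glued by `min` (`hasLatticeMassGap_anti`, `osData_hasMassGap_anti` re-proved below verbatim); §5 `WithoutSimple`
honoured AT `stub_orbitKantorovichWindow` (an `Ad G`-invariant direction of `𝔤`, e.g. the `u(1)` of `SU(2)×U(1)`,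
transmits the constant-curvature boundary mode undiminished, `Σk ≥ |W|(1-o(1))`, so the window condition fails —
the line uses `IsCompactSimpleLieGroup` exactly there and in `stub_transfer`; the engine, DLR and smoothing stubs
are `G`-blind and hold for photons); `WithoutBeta`/`WithoutTuning` enter the same stub (no `k`-uniform cell
exists without the tuning; at a finite-β first-order point two phases violate any DS condition); §1
`two_le_of_shape` (`2 ≤ M` is decoration — carried, unused); §6(i) no θ-uniform rate (here `Δ ≍ κ/t(θ)`,
`t(θ) ≍ e^{c/√θ}` on the UV branch); §6(ii) no observable-uniform constant (`C = C₀K_s²‖A‖‖B‖e^{…}`); PROVER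
NOTE on the transfer half (thermal traces on odd tori) — the lattice half here never meets a thermal trace, the
transfer stub inherits the note's route and its caveat (line card §Transfer). Landed Negative lemmas
(`Negative/ZeroCoupling*`, `Negative/BlowUp`): `β ≡ 0` has every gap and empties the tuning — consistent
(`stub_smoothingToGap` does not use `β_k → ∞`; only the physics stub does).
-/

/-! ## Integration status (lead c3, reshape 4c = c2's final reshape 4b re-registered, 2026-08-16T20Z)
Lead c3: `stub_slabClustering` (p123095) and `stub_transferSym` (p121787) are imported theorems (local copies deleted); the three
remaining sorries are `stub_orbitKantorovichWindow` (THE PHYSICS: weak-coupling orbit–Kantorovich window, open-problem strength) and the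
two RESIDUAL stubs `stub_volume` (β) / `stub_symmetrise` (α) = the restatement diff certified by leads 0, c1, a1, a2, c2 and drefute gen 2
(texts `Cruxes/LatticeGapOnTrajectory/RestatementC2.lean`). This seat lands the typed decomposition `USC → Vol → Sym → crux` as
importable `--supports` theorems (`Theorems/ParabolicTrajectoryLatticeGapOnTrajectorySplit.lean`).

## Integration status (lead c2, reshape 4, 2026-08-16)
Vocabulary: `Theorems/ParabolicTrajectoryLatticeGapOnTrajectoryDefs.lean` (p79110). LANDED stubs (imported, sorry removed):
`stub_wilsonTorusDLR` (p95462), `stub_specificationTower` (p95464), `stub_krFiniteSizeDecay` (p95465), `stub_torusFrames` (p95490+p95643),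
`stub_smoothingToGap` (p95467+p95642). OPEN: `stub_orbitKantorovichWindow` (the physics, R1).
RESHAPE 4 (this lead): the registered `stub_transfer` (all crux hypotheses + `HasLatticeMassGap` ⇒ `∃ Δ', TransferHalf r sch Δ'`),
certified mis-stated AT CRUX LEVEL by four leads + drefute, is split into
* `stub_slabClustering` — the line's honest plumbing debt: engine package + windows ⇒ sup-norm, cluster-expansion-format clustering of
  reflected autocorrelations of SLAB observables on the scheme's torus (`UniformSlabClustering`, stated raw);
* `stub_negReflectRP` — reflection positivity of the odd Wilson torus for the SITE reflection `t ↦ −t` (`GaugeConfig.negReflect`) on slab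
  observables (provable now: conjugate to the tree's `wilsonExpectation_oddReflectionPositive` by the half-torus shift);
* `stub_transferSym` — THE INFRASTRUCTURE (lead): slab clustering + volume growth `a_kL_k/log(1/a_k) → ∞` + site RP ⇒ the transfer clause
  for reflection-SYMMETRIC, polynomially bounded witness renormalisations (`TransferHalfSym`, raw), same rate, by the Hankel log-convexity
  chain (Literature `ReflectedCorrelationLogConvexity`, p116668/p116789) instantiated for `negReflect`, multiplicative polarisation and the
  landed density/limit machinery (`Transfer.hasMassGap_of_dense_clustering`, `tendsto_osCorr_rep`, `tendsto_osVar_rep`, p95381/p96292);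
* two RESIDUAL stubs that isolate the two crux-level defects in their sharpest typed form — `stub_volume` ((β): the crux hypotheses do
  not supply the physical-volume clause every torus-based transfer needs) and `stub_symmetrise` ((α): symmetric-polynomial transfer ⇒
  transfer for ALL witness renormalisations `sch'`, the filed clause). Neither residual is claimed provable: they ARE the restatement the
  planner must make (Cruxes/…/Restatement.lean `LatticeGapOnTrajectoryR` + a2's volume clause); under that restatement both disappear
  and the line is closed modulo `stub_orbitKantorovichWindow` and `stub_slabClustering`. -/

set_option autoImplicit false

noncomputable section

namespace Summit.QuantumFields.YangMills.Cruxes.LatticeGapOnTrajectory.OrbitKantorovichFiniteSize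

open scoped BigOperators Topology ENNReal ProbabilityTheory ComplexConjugate ComplexOrder
open Filter MeasureTheory
open Literature.MathematicalPhysics.QuantumLattice
open Literature.Probability.LatticeModels (Specification IsSpecification IsGibbsMeasure glueWith)
open Literature.MathematicalPhysics.QuantumFieldTheory
open Summit.QuantumFields.YangMills.Theses.ParabolicTrajectory

/-! ## §3 The registered stubs still open -/

/-- **stub_orbitKantorovichWindow** — THE PHYSICS (open; hardest; the line's bet). RESHAPE 4b (lead c2, after the wave-1
worker's `stub-misstated` on `stub_slabClustering`): the conclusion is `OrbitKRWindowsAlong` (verbatim, expanded) PLUS one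
conjunct `∃ p₀ K₀, ∀ᶠ k, |β_k|·α_k ≤ K₀ a_k^{−p₀}` on the SAME resolution `α` (physically free: `α_k ≍ λ/β_k` gives `p₀ = 0`;
it makes the TV-Lipschitz constant `∝ |β_k| α_k b_k⁴` of Wilson's slab kernels polynomial in `a_k⁻¹`, which is what slab
clustering needs); `OrbitKRWindowsAlong` follows by dropping it (`orbitKRWindowsAlong_of_P` below). The only stub using
`IsCompactSimpleLieGroup`, `β_k → ∞` and the tuning — Disproof §5 `WithoutSimple/WithoutBeta/WithoutTuning` are
honoured HERE). Along every M-adic tuned Wilson scheme there are `t, n₀, γ₀ < 1, α, K_s` with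
`OrbitKRWindowsAlong`: (W) the orbit–Kantorovich window condition — at tree level the influence of the boundary cell
`y` on the interior cell `x` is the cell-scale harmonic measure, `Σ_yΣ_x k = |W|` EXACTLY for the massless Gaussian
(marginal: no false positive; an `Ad G`-invariant direction of `𝔤` transmits the constant-curvature mode and keeps
it `≥ |W|(1−o(1))` at every scale — photons, `SU(2)×U(1)`), while a mass `m` gives `Σ_yΣ_x k ≈ |∂W|(1+1/(mb)) ≤ γ₀|W|`
once `b ≳ 1/m`, `2n₀+1 ≳ 8(1+1/(mb))/γ₀` (triage r1-1/r1-3 recomputation); the claim is that the interacting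
theory at `b = t·D_k ≫ ξ_k` sits on the massive side, `k`-uniformly, for every frame of scale in `[b,2b]`
(the cell must exceed the confinement length: `t(θ) ≍ e^{c/√θ}` on the UV branch, Disproof §6(i)); large fields are
NOT assumed absent (triage r1-1 (b): `~e^{(10.8−c)β}` fixed-threshold large plaquettes per cell) — the sup over
boundary data includes rough data and the transport must SYNCHRONISE them; boundary-pinned defects are the
refuter's target (r1-2 retracted one attempt). (R) the rough-centre bound (UV decoupling, holds even for photons).
Why it might be false: a weak-coupling massless phase for some compact simple `G` (the crux itself), or strong
mixing failing while the vacuum gap holds (Martinelli–Olivieri: boundary-pinned rigid defects — expected only for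
FINITE gauge groups). Perturbatively invisible (Σk ≳ |W| to all orders). Sources: DobrushinShlosman1985,
Balaban1988Convergent, Balaban1989LargeFieldII, OsterwalderSeiler1978, Guth1980, arXiv:hep-lat/0204023 (complete
screening of a constant abelian chromomagnetic background at `T = 0`), Luscher1986, MartinelliOlivieri1994. -/
theorem stub_orbitKantorovichWindow :
    ∀ (G : Type) [Group G] [TopologicalSpace G] [IsTopologicalGroup G] [CompactSpace G]
      [MeasurableSpace G] [BorelSpace G], IsCompactSimpleLieGroup G →
      ∀ (r : LatticeRep G) (M : ℕ) (θ : ℝ) (sch : SpeciesScheme (YMSpecies G)) (n : ℕ → ℕ),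
        2 ≤ M → 0 < θ → (∀ k, sch.a k = ((M : ℝ) ^ n k)⁻¹) → Tendsto sch.β atTop atTop →
        Tendsto (fun k => ((M : ℝ) ^ n k) ^ 8 *
            latticeConnectedCorr r.ρ (sch.β k) (sch.side k) r.curvature.F r.curvature.F (M ^ n k))
          atTop (𝓝 θ) →
        ∃ (t n₀ : ℕ) (γ₀ : ℝ) (α : ℕ → ℝ) (K : ℕ → ℝ), 1 ≤ t ∧ 0 ≤ γ₀ ∧ γ₀ < 1 ∧ (∀ k, 0 < α k) ∧
          (∃ (p₀ : ℕ) (K₀ : ℝ), ∀ᶠ k in atTop, |sch.β k| * α k ≤ K₀ * ((sch.a k)⁻¹) ^ p₀) ∧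
          ∀ s : ℕ, ∀ᶠ k in atTop, ∀ S : ℕ, sch.L k ≤ S →
            ∀ (μ : Fin 4 → ℕ) (q : (i : Fin 4) → ZMod (2 * S + 1) → ZMod (μ i + 1)),
              (∀ i, 2 * n₀ + 3 ≤ μ i + 1) → (∀ i, IsTorusFrame (2 * S + 1) (t * M ^ n k) (q i)) →
                (∃ kp : CoarseIdx μ → CoarseIdx μ → CoarseIdx μ → ℝ,
                    IsKRWindow (cellOf q) (orbitWeight r (α k) q) (torusYM r.ρ (sch.β k) (2 * S + 1)) 1 n₀ γ₀ kp) ∧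
                RoughCentreBound r (sch.β k) (2 * S + 1) q (α k) n₀ s (K s) := by
  sorry


/-! `stub_negReflectRP` (reshape 4b, `w < S`): LANDED p120012 — `Theorems/ParabolicTrajectoryLatticeGapOnTrajectoryStubNegReflectRP.lean`
(imported; the composition below uses the landed theorem by name). -/


/-- **stub_volume** — RESIDUAL (β), NOT CLAIMED PROVABLE: the crux hypotheses (M-adic shape, `β_k → ∞`, curvature tuning) do not
mention the torus half-sides `L_k` beyond `SpeciesScheme.tendsto_L : a_k L_k → ∞`, yet every transfer on the scheme's own tori
(thermal back-propagation `e^{−Δa_k(2L_k+1−m)} × poly(a_k⁻¹)` sup norms of renormalised smeared products; lead a2 (R-vol), lead c2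
NOTES §A(β)) needs `a_k L_k / log(1/a_k) → ∞`. Registered so that the composition type-checks against the crux AS FILED and so that
the defect is a typed target: the planner's restatement ADDS this clause to (B)'s hypotheses (free for (S): the tuner chooses `L_k`)
and the stub disappears. A disprover's `stub-misstated` on it is the expected reading, not news. -/
theorem stub_volume :
    ∀ (G : Type) [Group G] [TopologicalSpace G] [IsTopologicalGroup G] [CompactSpace G]
      [MeasurableSpace G] [BorelSpace G], IsCompactSimpleLieGroup G →
      ∀ (r : LatticeRep G) (M : ℕ) (θ : ℝ) (sch : SpeciesScheme (YMSpecies G)) (n : ℕ → ℕ),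
        2 ≤ M → 0 < θ → (∀ k, sch.a k = ((M : ℝ) ^ n k)⁻¹) → Tendsto sch.β atTop atTop →
        Tendsto (fun k => ((M : ℝ) ^ n k) ^ 8 *
            latticeConnectedCorr r.ρ (sch.β k) (sch.side k) r.curvature.F r.curvature.F (M ^ n k))
          atTop (𝓝 θ) →
        Tendsto (fun k => sch.a k * sch.L k / Real.log (sch.a k)⁻¹) atTop atTop := by
  sorry

/-- **stub_symmetrise** — RESIDUAL (α), NOT CLAIMED PROVABLE: from the transfer clause for reflection-SYMMETRIC, polynomially bounded
witness renormalisations (the conclusion of `stub_transferSym`, at some rate `Δ > 0`) to the crux's filed clause over ALL `sch'`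
(`TransferHalf`, at some rate). This is exactly the crux-level mis-statement certified by leads 0, c1, a1, a2 and the drefuter: the
T-diagonal pair of a species `s` is the lattice off-diagonal OS pair `(sΘ, s)` whose Cauchy–Schwarz constant carries the
unconstrained witness ratio `c_s(k)/c_{sΘ}(k)` (T's E2 pins only `c_s c_{sΘ}`; E1 has proper rotations only), so pointwise limits
of gapped lattice correlators are signed Laplace transforms of unbounded variation and keep no rate (Müntz;
`Cruxes/…/TransferObstruction.lean`). Registered so that the composition type-checks against the crux AS FILED; the planner's
restatement (Restatement.lean `LatticeGapOnTrajectoryR`: restrict `∀ sch'` to `IsReflectionSymmetric` + polynomial bounds, and let (A)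
output such a `sch'`) deletes it. A disprover's `stub-misstated` on it is the expected reading, not news. -/
theorem stub_symmetrise :
    ∀ (G : Type) [Group G] [TopologicalSpace G] [IsTopologicalGroup G] [CompactSpace G]
      [MeasurableSpace G] [BorelSpace G], IsCompactSimpleLieGroup G →
      ∀ (r : LatticeRep G) (M : ℕ) (θ : ℝ) (sch : SpeciesScheme (YMSpecies G)) (n : ℕ → ℕ),
        2 ≤ M → 0 < θ → (∀ k, sch.a k = ((M : ℝ) ^ n k)⁻¹) → Tendsto sch.β atTop atTop →
        Tendsto (fun k => ((M : ℝ) ^ n k) ^ 8 *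
            latticeConnectedCorr r.ρ (sch.β k) (sch.side k) r.curvature.F r.curvature.F (M ^ n k))
          atTop (𝓝 θ) →
        ∀ Δ : ℝ, 0 < Δ →
        (∀ sch' : SpeciesScheme (YMSpecies G), sch'.a = sch.a → sch'.β = sch.β → sch'.L = sch.L →
          sch'.IsReflectionSymmetric →
          (∀ s, ∃ (q : ℕ) (K : ℝ), ∀ k, |sch'.c s k| ≤ K * ((sch'.a k)⁻¹) ^ q ∧ |sch'.m s k| ≤ K * ((sch'.a k)⁻¹) ^ q) →
          ∀ T : OSData (YMSpecies G) 4, IsYangMillsFor r sch' T → T.HasMassGap Δ) →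
        ∃ Δ' : ℝ, 0 < Δ' ∧ TransferHalf r sch Δ' := by
  sorry

/-! ## §4 Gluing the two halves at independent rates (Disproof §2, re-proved verbatim) -/

section Anti

variable {G : Type} [Group G] [TopologicalSpace G] [IsTopologicalGroup G] [CompactSpace G]
  [MeasurableSpace G] [BorelSpace G] {ι : Type}

/-- The lattice half is antitone in the rate (Disproof §2 `hasLatticeMassGap_anti`). -/
theorem hasLatticeMassGap_anti (r : LatticeRep G) (sch : SpeciesScheme ι) {Δ Δ' : ℝ}
    (hΔ' : Δ' ≤ Δ) (h : HasLatticeMassGap r sch Δ) : HasLatticeMassGap r sch Δ' := by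
  intro A B
  obtain ⟨C, hC⟩ := h A B
  refine ⟨max C 0, hC.mono fun k hk S hS n hn => (hk S hS n hn).trans ?_⟩
  have hx : 0 ≤ sch.a k * n := mul_nonneg (sch.a_pos k).le (Nat.cast_nonneg n)
  calc C * Real.exp (-(Δ * (sch.a k * n)))
      ≤ max C 0 * Real.exp (-(Δ * (sch.a k * n))) :=
        mul_le_mul_of_nonneg_right (le_max_left _ _) (Real.exp_pos _).le
    _ ≤ max C 0 * Real.exp (-(Δ' * (sch.a k * n))) :=
        mul_le_mul_of_nonneg_left (Real.exp_le_exp.2 (by nlinarith)) (le_max_right _ _)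

end Anti

/-! ## §5 The composition (kernel-checked; `sorry` only inside the three sorried stubs it invokes) -/

/-- **The line closes the crux** (concludes `ParabolicTrajectory.LatticeGapOnTrajectory` BY NAME, no hypotheses; `sorry` only
inside the stubs it invokes). Fix the crux's data and its Borel structure; the physics stub gives the orbit–Kantorovich windows along
the scheme; the smoothing stub (landed), fed the engine and the DLR description, gives the lattice half at some `Δ₁ > 0`; the
slab-clustering stub gives cluster-expansion-format clustering at some `Δ₂ > 0`; the residual volume stub and the site-RP stub feed the
symmetric transfer stub, which gives the transfer clause for symmetric polynomially bounded witnesses at rate `Δ₂`; the residual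
symmetrisation stub turns it into the filed clause at some `Δ₃ > 0`; both halves are antitone, so `Δ = min Δ₁ Δ₃`. -/
theorem LatticeGapOnTrajectory_of : LatticeGapOnTrajectory := by
  intro G _ _ _ _ hG r M θ sch n hM hθ hshape hβ htune
  letI : MeasurableSpace G := borel G
  haveI : BorelSpace G := ⟨rfl⟩
  have hWP := stub_orbitKantorovichWindow G hG r M θ sch n hM hθ hshape hβ htune
  have hW : OrbitKRWindowsAlong r M sch n := by
    obtain ⟨t, n₀, γ₀, α, K, ht, hγ₀, hγ₁, hα, -, hrest⟩ := hWP
    exact ⟨t, n₀, γ₀, α, K, ht, hγ₀, hγ₁, hα, hrest⟩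
  obtain ⟨Δ₁, hΔ₁, hlat⟩ :=
    stub_smoothingToGap G r M sch n hM hshape stub_krFiniteSizeDecay stub_torusFrames stub_specificationTower
      (stub_wilsonTorusDLR G r) hW
  obtain ⟨Δ₂, hΔ₂, hclust⟩ :=
    stub_slabClustering G r M sch n hM hshape stub_krFiniteSizeDecay stub_torusFrames stub_specificationTower
      (stub_wilsonTorusDLR G r) hWP
  have hvol := stub_volume G hG r M θ sch n hM hθ hshape hβ htune
  have hsymTr := stub_transferSym G r M sch n Δ₂ hM hshape hβ hvol
    (fun {β} hb {S} hS F hF hFb {w} hw hdep => stub_negReflectRP r.ρ r.continuous hb hS F hF hFb hw hdep) hclust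
  obtain ⟨Δ₃, hΔ₃, htr⟩ := stub_symmetrise G hG r M θ sch n hM hθ hshape hβ htune Δ₂ hΔ₂ hsymTr
  exact ⟨min Δ₁ Δ₃, lt_min hΔ₁ hΔ₃, hasLatticeMassGap_anti r sch (min_le_left _ _) hlat,
    transferHalf_anti G r sch Δ₃ (min Δ₁ Δ₃) (min_le_right _ _) htr⟩

end Summit.QuantumFields.YangMills.Cruxes.LatticeGapOnTrajectory.OrbitKantorovichFiniteSize

end
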